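import Literature.NumberTheory.EllipticCurves.SkinnerUrban2014.PAdicUnitPeriodRatioAnyPrimeProofs
import HarnessLib

/-!
# Crux `MazurTateCongruenceAtTwoTop` (stmt-BirchSwinnertonDyer-25797 = 21416 BY NAME, route ThetaPartnerAtTwo, K1 row):
# the real part of a NÉRON LATTICE is `ℤ · Ω(A)/2`, generator attained — for a bare `IsNeronLatticeOf` hypothesis

Width seat `bsd-wall-tp2-p1-w4` g0 (`--supports stmt-BirchSwinnertonDyer-25797`; closes nothing; THEOREMS ONLY; BSD is not
proved by this). File K-a of the plan in `Cruxes/MazurTateCongruenceAtTwoTop/K1-HMU-PRINT-w4g0.md`: the binder `Hμ` of the landed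
K1 assemblies (`mazurTateCongruenceAtTwoTop_of_facts`, p619635; `…_of_fourFacts_mu`, p622986) is discharged from print through the
period lattice of the optimal quotient `A` of the DEPLETED form (named fact
`eichlerShimura_depletedOptimalQuotient_periodLattice_of_dvd`: `Λ_A = c · Λ_g`). That fact hands over `A` with a period pair `L`
and `IsNeronLatticeOf (A.baseChange ℂ) L` — NOT a `ModularParametrizationData` — so the tree's lattice lemmas
(`ModularParametrizationData.exists_mem_lattice_re_eq_realPeriodRat_div_two`, `…exists_re_eq_int_mul_realPeriodRat_div_two`,
whose proofs use only the field `isNeronLattice`) are re-run here for a bare `IsNeronLatticeOf` hypothesis: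

* `IsNeronLatticeOf.isReal'`, `IsNeronLatticeOf.discr_eq'`, `IsNeronLatticeOf.realPeriodRat_eq_numRealComponents_mul'`;
* `IsNeronLatticeOf.exists_re_eq_int_mul_realPeriodRat_div_two'` — `re Λ_A ⊆ ℤ · Ω(A)/2`;
* `IsNeronLatticeOf.exists_mem_lattice_re_eq_realPeriodRat_div_two'` — the generator `Ω(A)/2` is the real part of a period
  (rectangular: `Ω(A) = 2Ω₀`, `z = Ω₀`; rhombic: `Ω(A) = Ω₀`, `z = Ω₀/2 + iΩ₀'/2`), `Ω(A) = A.realPeriodRat` components included.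

References: Cremona 1997 §2.8 (p. 26); Lawden 1989 §6.16; Silverman AEC VI.5.1.
-/

noncomputable section

-- justification: the `Summit.BirchSwinnertonDyer.BirchSwinnertonDyer.…` path repeats a component (route-file convention)
set_option linter.dupNamespace false

open scoped ComplexConjugate

open Complex Literature.NumberTheory.EllipticCurves Literature.NumberTheory.EllipticCurves.ModularForms

namespace Summit.BirchSwinnertonDyer.BirchSwinnertonDyer.Theorems.MazurTateCongruenceAtTwoR

section NeronLattice

variable {A : WeierstrassCurve ℚ} {L : PeriodPair}

/-- `g₂(Λ_A) = c₄(A)/12` as a real number cast to `ℂ`. [folklore] -/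
theorem IsNeronLatticeOf.g₂_eq' (hL : IsNeronLatticeOf (A.baseChange ℂ) L) :
    L.g₂ = ((((A.c₄ : ℚ) : ℝ) / 12 : ℝ) : ℂ) := by
  rw [hL.1, WeierstrassCurve.baseChange, WeierstrassCurve.map_c₄, eq_ratCast]
  push_cast
  ring

/-- `g₃(Λ_A) = c₆(A)/216` as a real number cast to `ℂ`. [folklore] -/
theorem IsNeronLatticeOf.g₃_eq' (hL : IsNeronLatticeOf (A.baseChange ℂ) L) :
    L.g₃ = ((((A.c₆ : ℚ) : ℝ) / 216 : ℝ) : ℂ) := by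
  rw [hL.2, WeierstrassCurve.baseChange, WeierstrassCurve.map_c₆, eq_ratCast]
  push_cast
  ring

/-- **A Néron lattice of a curve over `ℚ` is a real lattice** (its invariants are real; uniqueness half of the
uniformization theorem, `PeriodPair.uniformization_unique_holds`). [cite: SilvermanAEC2009, Thm. VI.5.1] -/
theorem IsNeronLatticeOf.isReal' (hL : IsNeronLatticeOf (A.baseChange ℂ) L) : L.IsReal :=
  PeriodPair.isReal_of_g₂_g₃_real PeriodPair.uniformization_unique_holds
    (by rw [IsNeronLatticeOf.g₂_eq' hL, Complex.ofReal_im]) (by rw [IsNeronLatticeOf.g₃_eq' hL, Complex.ofReal_im])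

/-- `disc(Λ_A) = g₂³ − 27g₃² = Δ(A)` (over `ℝ`). [folklore] -/
theorem IsNeronLatticeOf.discr_eq' (hL : IsNeronLatticeOf (A.baseChange ℂ) L) :
    L.g₂.re ^ 3 - 27 * L.g₃.re ^ 2 = (A.baseChange ℝ).Δ := by
  rw [IsNeronLatticeOf.g₂_eq' hL, IsNeronLatticeOf.g₃_eq' hL, Complex.ofReal_re, Complex.ofReal_re,
    ← ModularParametrizationData.baseChange_real_c₄, ← ModularParametrizationData.baseChange_real_c₆,
    show ((A.baseChange ℝ).c₄ / 12) ^ 3 - 27 * ((A.baseChange ℝ).c₆ / 216) ^ 2 =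
      ((A.baseChange ℝ).c₄ ^ 3 - (A.baseChange ℝ).c₆ ^ 2) / 1728 by ring,
    ← (A.baseChange ℝ).c_relation]
  ring

/-- **`Ω(A) = #π₀(A(ℝ)) · Ω₀(Λ_A)`** for a Néron lattice `Λ_A` (item G06 `exists_periodPair_realPeriod_eq_holds` transported to `L`
by uniqueness of the lattice with given invariants). [cite: CremonaAlgorithms1997, §2.8 (p. 26)] -/
theorem IsNeronLatticeOf.realPeriodRat_eq_numRealComponents_mul' [A.IsElliptic]
    (hL : IsNeronLatticeOf (A.baseChange ℂ) L) :
    A.realPeriodRat = (A.baseChange ℝ).numRealComponents * L.minRealPeriod := by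
  haveI : (A.baseChange ℝ).IsElliptic := by
    rw [WeierstrassCurve.baseChange]; infer_instance
  obtain ⟨L', h₂', h₃', hΩ⟩ := (A.baseChange ℝ).exists_periodPair_realPeriod_eq_holds
  have hlat : L.lattice = L'.lattice :=
    PeriodPair.uniformization_unique_holds _ _
      (by rw [h₂', IsNeronLatticeOf.g₂_eq' hL, ModularParametrizationData.baseChange_real_c₄])
      (by rw [h₃', IsNeronLatticeOf.g₃_eq' hL, ModularParametrizationData.baseChange_real_c₆])
  rw [WeierstrassCurve.realPeriodRat_def, hΩ, PeriodPair.minRealPeriod_def, hlat]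

/-- **`re Λ_A ⊆ ℤ · Ω(A)/2`** for a Néron lattice (rectangular: `Ω(A) = 2Ω₀`, `re Λ ⊆ ℤΩ₀`; rhombic: `Ω(A) = Ω₀`,
`re Λ ⊆ ℤ(Ω₀/2)`). [cite: CremonaAlgorithms1997, §2.8 (p. 26)] -/
theorem IsNeronLatticeOf.exists_re_eq_int_mul_realPeriodRat_div_two' [A.IsElliptic]
    (hL : IsNeronLatticeOf (A.baseChange ℂ) L) {z : ℂ} (hz : z ∈ L.lattice) :
    ∃ k : ℤ, z.re = k * (A.realPeriodRat / 2) := by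
  rw [IsNeronLatticeOf.realPeriodRat_eq_numRealComponents_mul' hL]
  by_cases hΔ : 0 < (A.baseChange ℝ).Δ
  · rw [(A.baseChange ℝ).numRealComponents_of_Δ_pos hΔ]
    have hdisc : 0 < L.g₂.re ^ 3 - 27 * L.g₃.re ^ 2 := by rwa [IsNeronLatticeOf.discr_eq' hL]
    obtain ⟨k, hk⟩ := (IsNeronLatticeOf.isReal' hL).exists_re_eq_int_mul_of_discr_pos hdisc hz
    exact ⟨k, by rw [hk]; push_cast; ring⟩
  · rw [(A.baseChange ℝ).numRealComponents_of_Δ_nonpos (not_lt.mp hΔ)]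
    obtain ⟨k, hk⟩ := (IsNeronLatticeOf.isReal' hL).exists_re_eq_int_mul_half hz
    exact ⟨k, by rw [hk]; push_cast; ring⟩

/-- **The half Néron period is the real part of a period**: `Ω(A)/2 = re z` for some `z ∈ Λ_A`, so `re Λ_A = ℤ · Ω(A)/2`
exactly. Rectangular (`Δ > 0`): `z = Ω₀`; rhombic: `z = Ω₀/2 + iΩ₀'/2 ∈ Λ` by `IsReal.discr_pos_of_halfPeriodI_add_notMem`
(Lawden §6.16). [cite: CremonaAlgorithms1997, §2.8 (p. 26)] [cite: Lawden1989, §6.16] -/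
theorem IsNeronLatticeOf.exists_mem_lattice_re_eq_realPeriodRat_div_two' [A.IsElliptic]
    (hL : IsNeronLatticeOf (A.baseChange ℂ) L) :
    ∃ z ∈ L.lattice, z.re = A.realPeriodRat / 2 := by
  haveI : (A.baseChange ℝ).IsElliptic := by
    rw [WeierstrassCurve.baseChange]; infer_instance
  have hR : L.IsReal := IsNeronLatticeOf.isReal' hL
  rw [IsNeronLatticeOf.realPeriodRat_eq_numRealComponents_mul' hL]
  by_cases hΔ : 0 < (A.baseChange ℝ).Δ
  · refine ⟨(L.minRealPeriod : ℂ), hR.minRealPeriod_mem_lattice, ?_⟩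
    rw [(A.baseChange ℝ).numRealComponents_of_Δ_pos hΔ, Complex.ofReal_re]
    push_cast
    ring
  · have hΔ0 : (A.baseChange ℝ).Δ ≠ 0 := (A.baseChange ℝ).isUnit_Δ.ne_zero
    have hdisc : L.g₂.re ^ 3 - 27 * L.g₃.re ^ 2 ≠ 0 := by
      rw [IsNeronLatticeOf.discr_eq' hL]; exact hΔ0
    have hmem : I * (((L.mulLeft I I_ne_zero).minRealPeriod / 2 : ℝ) : ℂ) +
        ((L.minRealPeriod / 2 : ℝ) : ℂ) ∈ L.lattice := by
      by_contra hnot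
      exact hΔ (by
        rw [← IsNeronLatticeOf.discr_eq' hL]
        exact hR.discr_pos_of_halfPeriodI_add_notMem hdisc hnot)
    refine ⟨_, hmem, ?_⟩
    rw [(A.baseChange ℝ).numRealComponents_of_Δ_nonpos (not_lt.mp hΔ)]
    simp only [Complex.add_re, Complex.mul_re, Complex.I_re, Complex.I_im, Complex.ofReal_re,
      Complex.ofReal_im, zero_mul, one_mul, mul_zero, sub_zero, zero_add, Nat.cast_one]

/-- **Scaled form**: if `Λ_A = c · Λ'` for a subgroup `Λ' ⊆ ℂ` and a rational `c ≠ 0` (the shape in which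
`eichlerShimura_depletedOptimalQuotient_periodLattice_of_dvd` hands over the period lattice `Λ' = Λ_g` of the depleted form),
then some `w ∈ Λ'` has `re w = Ω(A)/(2c)`, and every `w ∈ Λ'` has `re w ∈ ℤ · Ω(A)/(2c)`. [cite: CremonaAlgorithms1997, §2.8 (p. 26)] -/
theorem IsNeronLatticeOf.exists_mem_re_eq_realPeriodRat_div_of_lattice_eq_smul' [A.IsElliptic]
    (hL : IsNeronLatticeOf (A.baseChange ℂ) L) {Λ' : AddSubgroup ℂ} {c : ℚ} (hc : c ≠ 0)
    (hlat : ∀ z : ℂ, z ∈ L.lattice ↔ ∃ w ∈ Λ', z = (c : ℂ) * w) :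
    (∃ w ∈ Λ', w.re = A.realPeriodRat / 2 / c) ∧
      ∀ w ∈ Λ', ∃ k : ℤ, w.re = k * (A.realPeriodRat / 2 / c) := by
  have hcR : (c : ℝ) ≠ 0 := by exact_mod_cast hc
  have hre : ∀ w : ℂ, ((c : ℂ) * w).re = (c : ℝ) * w.re := fun w ↦ by
    rw [show (c : ℂ) = ((c : ℝ) : ℂ) from (Complex.ofReal_ratCast c).symm, Complex.re_ofReal_mul]
  constructor
  · obtain ⟨z, hz, hzre⟩ := IsNeronLatticeOf.exists_mem_lattice_re_eq_realPeriodRat_div_two' hL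
    obtain ⟨w, hw, rfl⟩ := (hlat z).mp hz
    refine ⟨w, hw, ?_⟩
    rw [hre] at hzre
    field_simp
    linarith
  · intro w hw
    have hz : (c : ℂ) * w ∈ L.lattice := (hlat _).mpr ⟨w, hw, rfl⟩
    obtain ⟨k, hk⟩ := IsNeronLatticeOf.exists_re_eq_int_mul_realPeriodRat_div_two' hL hz
    refine ⟨k, ?_⟩
    rw [hre] at hk
    field_simp
    linarith

end NeronLattice

end Summit.BirchSwinnertonDyer.BirchSwinnertonDyer.Theorems.MazurTateCongruenceAtTwoR

end
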